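import Summits.QuantumFields.YangMills.Theorems.BalabanUVNodesN19SingleModeFirstOrder
import Summits.QuantumFields.YangMills.Theorems.BalabanUVNodesN19SingleModeMomentLadder

/-!
# YM-DAG node N19 (= NE7 proper) — THE FIRST-ORDER TAIL CORRECTION IN THE UNIFORM MIXED-MOMENT CURRENCY, PART A: the steps WITH MASS
# (the TAYLOR step `× Σ_{j<n}(iωB)^j∕j!` — mass `≤ 2M(1 + ω·m_B)^{n−1}`, error `e^{ωR−n}` — and the first-order step `× (1 + iωΔ)` — mass `≤ M(1 + ω·m_Δ)`)

Cell `pub-ymgap`, HUMAN RULING D-0062 (Track A) ∕ D-0149 (work-bound push), R141 (C) wider-strategy seat `pub-ymgap-dag-n19-e` (strategy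
s3 = ALTERNATIVE CURRENCY), generation g32, module 5 (lineage module 143).  Route `Summits/QuantumFields/YangMills/Theses/BalabanUVNodes.lean`,
cluster item K3⁸ «SpineGivenEndpointR13SepCoPHV» (stmt-QuantumFields-27366); filed `--supports` that item `--as helper` (it proves no registered
stub).  COUNT-NEUTRAL: [folklore]∕[bookkeeping] over Mathlib and the lineage BY NAME — module 118 `…N19SingleModeMultiscale` (`eval_coeffSum`,
`taylorPair_eval`, `Literature…Brownawell….norm_cexp_sub_sum_le` through it), module 127 `…N19CoefficientMassPricing` (`mass_mul_le`, `mass_sub_le`,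
`mass_add_le`, `mass_C_le`, `mass_coeffSum_le`), module 139 `…N19SingleModeFirstOrder` (the device); no laws in this part, no scheme object, no Theses
import; NOT a discharge claim.

CONTEXT.  Modules 139–141 made the single-mode law of the DEGREE model log-free (`dist_∞(e^{iωS_d}, Π_t) = Θ(ωd∕t)` for `ωd ≲ t∕log²t`) by the
first-order tail correction.  The lineage's UNIFORM MIXED-MOMENT currency (laws with `r`-close mixed moments, `L = log r⁻¹`; the currency of N19's
uniform `Target`) has the row `ωd·log2∕(20πL) ≤ sup|∫sin(ωS_d)d(Q−P)| ≲ C·ωd·log²L∕L` (modules 138 ∕ 129): two-sided up to `log²L`.  Module 129's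
ladder uses JACKSON pairs at every scale (error `ωR_lπ∕m_l`, polynomial in the degree), so its `J+1` levels each cost `≍ ωd∕2^J` — the `log²`.  This
part re-runs the ladder's steps with the TAYLOR pair of module 118 (error `e^{ωR−n}`, geometric) and records COEFFICIENT MASS instead of degree: the
mass of `Σ_{j<n}(iωB)^j∕j!` planted in `B` is `≤ Σ_{j<n}(ω·m_B)^j∕j! ≤ (1 + ω·m_B)^{n−1}`, so `log mass ≲ (n−1)·log(1 + ω·m_B)` — for the Jackson
ladder `log(ω·m_B(l)) ≍ 2^l·log 81`, i.e. the log-mass of a level is its DEGREE COST times `log 81`: PART B∕C transplant modules 139∕140 to the moment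
currency with `L` in the role of `t`.
§1 `sum_pow_div_factorial_le` (`Σ_{j<n}x^j∕j! ≤ (1+x)^{n−1}`, `x ≥ 0`) · `abs_re_taylorCoeff_le` ∕ `abs_im_taylorCoeff_le` (`|Re∕Im((ωi)^j∕j!)| ≤ ω^j∕j!`) ·
§2 ★ `exists_pair_taylor_step_mass` (module 118's multiplicative step WITH MASS: masses `≤ 2M(1 + ω·m_B)^{n−1}`, error `ε + (1+ε)e^{ωR−n}`) ·
§3 ★ `exists_pair_near_cexp_sum_taylor_mass` (the ladder: masses `≤ ∏_l 2(1 + ω·m_B(l))^{n_l−1}`, error `2Σ_l e^{ωR_l−n_l}`) ·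
§4 ★ `exists_pair_firstOrder_step_mass` (module 139's first-order step WITH MASS: masses `≤ M(1 + ω·m_Δ)`, error `ε(1+ρ+τ) + ρ² + τ`).

HONEST FRAMING (binding).  Elementary and [folklore]; NO consumer in the DAG today (the seat's own currency map); nothing of Bałaban's instantiated;
NE7 NOT PRINTED, NOT proved; N19 NOT discharged; count-neutral.  One finite `T⁴` programme at fixed `ε`; nothing continuum ∕ `ℝ⁴` ∕ OS ∕ mass-gap ∕
Clay.  0 `def` ∕ 0 `sorry`.
-/

noncomputable section

open Finset Complex

namespace Summit.QuantumFields.YangMills.Theorems.BalabanUVNodesN19SingleModeMomentFirstOrder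

open Literature.NumberTheory.Transcendental.Brownawell (norm_cexp_sub_sum_le)
open Summit.QuantumFields.YangMills.Theorems.BalabanUVNodesN19SingleModeMultiscale (eval_coeffSum taylorPair_eval)
open Summit.QuantumFields.YangMills.Theorems.BalabanUVNodesN19CoefficientMassPricing

variable {ι : Type*}

/-! ## §1 Taylor coefficients and their mass [bookkeeping] -/

/-- `Σ_{j<n} x^j∕j! ≤ (1 + x)^{n−1}` for `x ≥ 0` (termwise: `1∕j! ≤ 1 ≤ C(n−1, j)`). [bookkeeping] -/
theorem sum_pow_div_factorial_le {x : ℝ} (hx : 0 ≤ x) (n : ℕ) :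
    ∑ j ∈ range n, x ^ j / (j.factorial : ℝ) ≤ (1 + x) ^ (n - 1) := by
  cases n with
  | zero => simp
  | succ n =>
    rw [Nat.add_sub_cancel]
    have h : (1 + x) ^ n = ∑ j ∈ range (n + 1), x ^ j * ((n.choose j : ℕ) : ℝ) := by
      rw [add_comm (1 : ℝ) x, add_pow]
      exact Finset.sum_congr rfl fun j _ => by rw [one_pow, mul_one]
    rw [h]
    refine Finset.sum_le_sum fun j hj => ?_
    have hjn : j ≤ n := Nat.lt_succ_iff.1 (mem_range.1 hj)
    have hfac : (1 : ℝ) ≤ j.factorial := by exact_mod_cast Nat.succ_le_of_lt (Nat.factorial_pos j)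
    have hch : (1 : ℝ) ≤ ((n.choose j : ℕ) : ℝ) := by exact_mod_cast Nat.succ_le_of_lt (Nat.choose_pos hjn)
    have hxj : 0 ≤ x ^ j := pow_nonneg hx _
    calc x ^ j / (j.factorial : ℝ) ≤ x ^ j / 1 := div_le_div_of_nonneg_left hxj one_pos hfac
      _ = x ^ j * 1 := by rw [div_one, mul_one]
      _ ≤ x ^ j * ((n.choose j : ℕ) : ℝ) := mul_le_mul_of_nonneg_left hch hxj

/-- `‖(ωi)^j∕j!‖ = ω^j∕j!` for `ω ≥ 0`. [bookkeeping] -/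
theorem norm_taylorCoeff {ω : ℝ} (hω : 0 ≤ ω) (j : ℕ) :
    ‖((ω : ℂ) * I) ^ j / (j.factorial : ℂ)‖ = ω ^ j / (j.factorial : ℝ) := by
  rw [norm_div, norm_pow, norm_mul, Complex.norm_real, Complex.norm_I, mul_one, Real.norm_eq_abs, abs_of_nonneg hω,
    Complex.norm_natCast]

/-- `|Re((ωi)^j∕j!)| ≤ ω^j∕j!`. [bookkeeping] -/
theorem abs_re_taylorCoeff_le {ω : ℝ} (hω : 0 ≤ ω) (j : ℕ) :
    |(((ω : ℂ) * I) ^ j / (j.factorial : ℂ)).re| ≤ ω ^ j / (j.factorial : ℝ) :=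
  (Complex.abs_re_le_norm _).trans_eq (norm_taylorCoeff hω j)

/-- `|Im((ωi)^j∕j!)| ≤ ω^j∕j!`. [bookkeeping] -/
theorem abs_im_taylorCoeff_le {ω : ℝ} (hω : 0 ≤ ω) (j : ℕ) :
    |(((ω : ℂ) * I) ^ j / (j.factorial : ℂ)).im| ≤ ω ^ j / (j.factorial : ℝ) :=
  (Complex.abs_im_le_norm _).trans_eq (norm_taylorCoeff hω j)

/-- **MASS OF A PLANTED TAYLOR PAIR.**  If `|c_j| ≤ ω^j∕j!` (`ω ≥ 0`) and `mass B ≤ m_B` then `mass(Σ_{j<n} C(c_j)·B^j) ≤ (1 + ω·m_B)^{n−1}`.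
[bookkeeping] -/
theorem mass_taylorPlant_le {ω : ℝ} (hω : 0 ≤ ω) {c : ℕ → ℝ} (hc : ∀ j, |c j| ≤ ω ^ j / (j.factorial : ℝ))
    {B : MvPolynomial ι ℝ} {mB : ℝ} (hB : (∑ s ∈ B.support, |B.coeff s|) ≤ mB) (n : ℕ) :
    (∑ s ∈ (∑ j ∈ range n, MvPolynomial.C (c j) * B ^ j).support, |(∑ j ∈ range n, MvPolynomial.C (c j) * B ^ j).coeff s|) ≤
      (1 + ω * mB) ^ (n - 1) := by
  have hB0 : 0 ≤ ∑ s ∈ B.support, |B.coeff s| := Finset.sum_nonneg fun s _ => abs_nonneg _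
  have hmB0 : 0 ≤ mB := hB0.trans hB
  refine (mass_coeffSum_le c B n).trans ?_
  calc ∑ j ∈ range n, |c j| * (∑ s ∈ B.support, |B.coeff s|) ^ j ≤ ∑ j ∈ range n, ω ^ j / (j.factorial : ℝ) * mB ^ j :=
        Finset.sum_le_sum fun j _ => mul_le_mul (hc j) (pow_le_pow_left₀ hB0 hB j) (pow_nonneg hB0 _) (by positivity)
    _ = ∑ j ∈ range n, (ω * mB) ^ j / (j.factorial : ℝ) := Finset.sum_congr rfl fun j _ => by rw [mul_pow]; ring
    _ ≤ (1 + ω * mB) ^ (n - 1) := sum_pow_div_factorial_le (mul_nonneg hω hmB0) n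

/-! ## §2 ★ The Taylor step with mass [folklore] -/

/-- ★ **MODULE 118's MULTIPLICATIVE STEP, WITH COEFFICIENT MASS.**  Let `(Cr, Ci)` have masses `≤ M` and `‖Cr(x) + Ci(x)·i − e^{iθ(x)}‖ ≤ ε` on the
cube (`ε ≥ 0`), `B` of mass `≤ m_B` with `|B(x)| ≤ R` on the cube, `ω ≥ 0`, `n ≥ 1` with `e²ωR ≤ n`.  With the Taylor pair `(Qr, Qi)` of order `n`
of `e^{iωB}` planted in `B`, the pair `(Cr·Qr − Ci·Qi, Cr·Qi + Ci·Qr)` has masses `≤ 2M(1 + ω·m_B)^{n−1}` and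
`‖· − e^{i(θ(x) + ωB(x))}‖ ≤ ε + (1 + ε)e^{ωR−n}` on the cube (the error bookkeeping is module 118's verbatim). [folklore] -/
theorem exists_pair_taylor_step_mass {θ : (ι → ℝ) → ℝ} {Cr Ci B : MvPolynomial ι ℝ} {M mB R ε ω : ℝ} {n : ℕ}
    (hCr : (∑ s ∈ Cr.support, |Cr.coeff s|) ≤ M) (hCi : (∑ s ∈ Ci.support, |Ci.coeff s|) ≤ M)
    (hBm : (∑ s ∈ B.support, |B.coeff s|) ≤ mB) (hε : 0 ≤ ε)
    (happ : ∀ x : ι → ℝ, (∀ i, x i ∈ Set.Icc (-1 : ℝ) 1) →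
      ‖((MvPolynomial.eval x Cr : ℝ) : ℂ) + ((MvPolynomial.eval x Ci : ℝ) : ℂ) * I - exp ((θ x : ℂ) * I)‖ ≤ ε)
    (hBR : ∀ x : ι → ℝ, (∀ i, x i ∈ Set.Icc (-1 : ℝ) 1) → |MvPolynomial.eval x B| ≤ R)
    (hω : 0 ≤ ω) (hn1 : 1 ≤ n) (hn : Real.exp 2 * (ω * R) ≤ n) :
    ∃ Cr' Ci' : MvPolynomial ι ℝ,
      (∑ s ∈ Cr'.support, |Cr'.coeff s|) ≤ 2 * M * (1 + ω * mB) ^ (n - 1) ∧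
      (∑ s ∈ Ci'.support, |Ci'.coeff s|) ≤ 2 * M * (1 + ω * mB) ^ (n - 1) ∧
      ∀ x : ι → ℝ, (∀ i, x i ∈ Set.Icc (-1 : ℝ) 1) →
        ‖((MvPolynomial.eval x Cr' : ℝ) : ℂ) + ((MvPolynomial.eval x Ci' : ℝ) : ℂ) * I -
            exp (((θ x + ω * MvPolynomial.eval x B : ℝ) : ℂ) * I)‖ ≤ ε + (1 + ε) * Real.exp (ω * R - n) := by
  set c : ℕ → ℂ := fun j => ((ω : ℂ) * I) ^ j / (j.factorial : ℂ) with hc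
  set Qr : MvPolynomial ι ℝ := ∑ j ∈ range n, MvPolynomial.C ((c j).re) * B ^ j with hQr
  set Qi : MvPolynomial ι ℝ := ∑ j ∈ range n, MvPolynomial.C ((c j).im) * B ^ j with hQi
  set μ : ℝ := (1 + ω * mB) ^ (n - 1) with hμ
  have hQr_mass : (∑ s ∈ Qr.support, |Qr.coeff s|) ≤ μ :=
    mass_taylorPlant_le hω (fun j => abs_re_taylorCoeff_le hω j) hBm n
  have hQi_mass : (∑ s ∈ Qi.support, |Qi.coeff s|) ≤ μ :=
    mass_taylorPlant_le hω (fun j => abs_im_taylorCoeff_le hω j) hBm n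
  have hM0 : 0 ≤ M := (Finset.sum_nonneg fun s _ => abs_nonneg _).trans hCr
  refine ⟨Cr * Qr - Ci * Qi, Cr * Qi + Ci * Qr, ?_, ?_, ?_⟩
  · calc _ ≤ _ := mass_sub_le _ _
      _ ≤ M * μ + M * μ := add_le_add ((mass_mul_le _ _).trans (mul_le_mul hCr hQr_mass (Finset.sum_nonneg fun s _ => abs_nonneg _) hM0))
          ((mass_mul_le _ _).trans (mul_le_mul hCi hQi_mass (Finset.sum_nonneg fun s _ => abs_nonneg _) hM0))
      _ = 2 * M * μ := by ring
  · calc _ ≤ _ := mass_add_le _ _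
      _ ≤ M * μ + M * μ := add_le_add ((mass_mul_le _ _).trans (mul_le_mul hCr hQi_mass (Finset.sum_nonneg fun s _ => abs_nonneg _) hM0))
          ((mass_mul_le _ _).trans (mul_le_mul hCi hQr_mass (Finset.sum_nonneg fun s _ => abs_nonneg _) hM0))
      _ = 2 * M * μ := by ring
  · intro x hx
    set b : ℝ := MvPolynomial.eval x B with hb
    set z : ℂ := ((MvPolynomial.eval x Cr : ℝ) : ℂ) + ((MvPolynomial.eval x Ci : ℝ) : ℂ) * I with hz
    set w : ℂ := ((MvPolynomial.eval x Qr : ℝ) : ℂ) + ((MvPolynomial.eval x Qi : ℝ) : ℂ) * I with hw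
    have hprod : ((MvPolynomial.eval x (Cr * Qr - Ci * Qi) : ℝ) : ℂ) +
        ((MvPolynomial.eval x (Cr * Qi + Ci * Qr) : ℝ) : ℂ) * I = z * w := by
      simp only [map_sub, map_add, map_mul, hz, hw]
      push_cast
      linear_combination (-((MvPolynomial.eval x Ci : ℝ) : ℂ) * ((MvPolynomial.eval x Qi : ℝ) : ℂ)) * Complex.I_mul_I
    have hwT : w = ∑ j ∈ range n, (((ω * b : ℝ) : ℂ) * I) ^ j / (j.factorial : ℂ) := by
      rw [hw, hQr, hQi, eval_coeffSum, eval_coeffSum]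
      exact taylorPair_eval ω b n
    have hs : ‖((ω * b : ℝ) : ℂ) * I‖ ≤ ω * R := by
      rw [norm_mul, Complex.norm_real, Complex.norm_I, mul_one, Real.norm_eq_abs, abs_mul, abs_of_nonneg hω]
      exact mul_le_mul_of_nonneg_left (hBR x hx) hω
    have hwerr : ‖w - exp (((ω * b : ℝ) : ℂ) * I)‖ ≤ Real.exp (ω * R - n) := by
      rw [norm_sub_rev, hwT]; exact norm_cexp_sub_sum_le hs hn1 hn
    have hzerr : ‖z - exp ((θ x : ℂ) * I)‖ ≤ ε := happ x hx
    have hz1 : ‖z‖ ≤ 1 + ε := by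
      calc ‖z‖ = ‖exp ((θ x : ℂ) * I) + (z - exp ((θ x : ℂ) * I))‖ := by rw [add_sub_cancel]
        _ ≤ ‖exp ((θ x : ℂ) * I)‖ + ‖z - exp ((θ x : ℂ) * I)‖ := norm_add_le _ _
        _ ≤ 1 + ε := by rw [Complex.norm_exp_ofReal_mul_I]; exact add_le_add le_rfl hzerr
    have harg : ((θ x + ω * b : ℝ) : ℂ) * I = (θ x : ℂ) * I + ((ω * b : ℝ) : ℂ) * I := by push_cast; ring
    have hexp : exp (((θ x + ω * b : ℝ) : ℂ) * I) = exp ((θ x : ℂ) * I) * exp (((ω * b : ℝ) : ℂ) * I) := by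
      rw [harg, Complex.exp_add]
    rw [hprod, hexp]
    have hsplit : z * w - exp ((θ x : ℂ) * I) * exp (((ω * b : ℝ) : ℂ) * I) =
        z * (w - exp (((ω * b : ℝ) : ℂ) * I)) + (z - exp ((θ x : ℂ) * I)) * exp (((ω * b : ℝ) : ℂ) * I) := by ring
    rw [hsplit]
    calc ‖z * (w - exp (((ω * b : ℝ) : ℂ) * I)) + (z - exp ((θ x : ℂ) * I)) * exp (((ω * b : ℝ) : ℂ) * I)‖
        ≤ ‖z * (w - exp (((ω * b : ℝ) : ℂ) * I))‖ + ‖(z - exp ((θ x : ℂ) * I)) * exp (((ω * b : ℝ) : ℂ) * I)‖ :=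
          norm_add_le _ _
      _ = ‖z‖ * ‖w - exp (((ω * b : ℝ) : ℂ) * I)‖ + ‖z - exp ((θ x : ℂ) * I)‖ * 1 := by
          rw [norm_mul, norm_mul, Complex.norm_exp_ofReal_mul_I]
      _ ≤ (1 + ε) * Real.exp (ω * R - n) + ε * 1 :=
          add_le_add (mul_le_mul hz1 hwerr (norm_nonneg _) (by linarith)) (mul_le_mul_of_nonneg_right hzerr zero_le_one)
      _ = ε + (1 + ε) * Real.exp (ω * R - n) := by ring

/-! ## §3 ★ The Taylor ladder with mass [folklore] -/

/-- ★ **THE TELESCOPING LADDER WITH TAYLOR STEPS AND MASS.**  Increments `B_l` with masses `≤ m_B(l)` and cube bounds `|B_l| ≤ R_l`, Taylor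
orders `n_l ≥ 1` with `e²ωR_l ≤ n_l`, `ω ≥ 0`, base phase `φ₀`, and `Σ_{l<J} e^{ωR_l−n_l} ≤ ½`: there is a pair `(Cr, Ci)` of masses
`≤ ∏_{l<J} 2(1 + ω·m_B(l))^{n_l−1}` with `‖Cr(x) + Ci(x)·i − e^{i(φ₀ + ωΣ_{l<J}B_l(x))}‖ ≤ 2Σ_{l<J} e^{ωR_l−n_l}` on `[−1,1]^ι`
(induction on `J` with §2; the running error stays `≤ 1`). [folklore] -/
theorem exists_pair_near_cexp_sum_taylor_mass (φ₀ : ℝ) {ω : ℝ} (hω : 0 ≤ ω) (B : ℕ → MvPolynomial ι ℝ) (mB R : ℕ → ℝ)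
    (n : ℕ → ℕ) :
    ∀ J : ℕ, (∀ l, l < J → (∑ s ∈ (B l).support, |(B l).coeff s|) ≤ mB l) →
      (∀ l, l < J → ∀ x : ι → ℝ, (∀ i, x i ∈ Set.Icc (-1 : ℝ) 1) → |MvPolynomial.eval x (B l)| ≤ R l) →
      (∀ l, l < J → 1 ≤ n l ∧ Real.exp 2 * (ω * R l) ≤ n l) →
      (∑ l ∈ range J, Real.exp (ω * R l - n l)) ≤ 1 / 2 →
      ∃ Cr Ci : MvPolynomial ι ℝ,
        (∑ s ∈ Cr.support, |Cr.coeff s|) ≤ ∏ l ∈ range J, 2 * (1 + ω * mB l) ^ (n l - 1) ∧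
        (∑ s ∈ Ci.support, |Ci.coeff s|) ≤ ∏ l ∈ range J, 2 * (1 + ω * mB l) ^ (n l - 1) ∧
        ∀ x : ι → ℝ, (∀ i, x i ∈ Set.Icc (-1 : ℝ) 1) →
          ‖((MvPolynomial.eval x Cr : ℝ) : ℂ) + ((MvPolynomial.eval x Ci : ℝ) : ℂ) * I -
              exp (((φ₀ + ω * ∑ l ∈ range J, MvPolynomial.eval x (B l) : ℝ) : ℂ) * I)‖ ≤
            2 * ∑ l ∈ range J, Real.exp (ω * R l - n l) := by
  intro J
  induction J with
  | zero =>
    intro _ _ _ _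
    refine ⟨MvPolynomial.C (Real.cos φ₀), MvPolynomial.C (Real.sin φ₀), ?_, ?_, ?_⟩
    · rw [prod_range_zero]; exact (mass_C_le _).trans (Real.abs_cos_le_one _)
    · rw [prod_range_zero]; exact (mass_C_le _).trans (Real.abs_sin_le_one _)
    · intro x _
      rw [MvPolynomial.eval_C, MvPolynomial.eval_C, sum_range_zero, sum_range_zero, mul_zero, add_zero, mul_zero]
      have h0 : ((Real.cos φ₀ : ℝ) : ℂ) + ((Real.sin φ₀ : ℝ) : ℂ) * I = exp ((φ₀ : ℂ) * I) := by
        rw [Complex.exp_mul_I, Complex.ofReal_cos, Complex.ofReal_sin]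
      rw [h0, sub_self, norm_zero]
  | succ J ih =>
    intro hmass hBR hn hη
    have hηJ : 0 ≤ Real.exp (ω * R J - n J) := (Real.exp_pos _).le
    have hη' : ∑ l ∈ range J, Real.exp (ω * R l - n l) ≤ 1 / 2 := by
      rw [Finset.sum_range_succ] at hη; linarith
    obtain ⟨Cr, Ci, hCr, hCi, happ⟩ := ih (fun l hl => hmass l (Nat.lt_succ_of_lt hl)) (fun l hl => hBR l (Nat.lt_succ_of_lt hl))
      (fun l hl => hn l (Nat.lt_succ_of_lt hl)) hη'
    have hsum0 : 0 ≤ ∑ l ∈ range J, Real.exp (ω * R l - n l) := Finset.sum_nonneg fun l _ => (Real.exp_pos _).le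
    have hε0 : 0 ≤ 2 * ∑ l ∈ range J, Real.exp (ω * R l - n l) := by positivity
    have hε1 : 2 * ∑ l ∈ range J, Real.exp (ω * R l - n l) ≤ 1 := by linarith
    obtain ⟨Cr', Ci', hCr', hCi', happ'⟩ :=
      exists_pair_taylor_step_mass (θ := fun x => φ₀ + ω * ∑ l ∈ range J, MvPolynomial.eval x (B l))
        hCr hCi (hmass J (Nat.lt_succ_self J)) hε0 happ (hBR J (Nat.lt_succ_self J)) hω (hn J (Nat.lt_succ_self J)).1
        (hn J (Nat.lt_succ_self J)).2
    have hprod : 2 * (∏ l ∈ range J, 2 * (1 + ω * mB l) ^ (n l - 1)) * (1 + ω * mB J) ^ (n J - 1) =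
        ∏ l ∈ range (J + 1), 2 * (1 + ω * mB l) ^ (n l - 1) := by
      rw [Finset.prod_range_succ]; ring
    refine ⟨Cr', Ci', hprod ▸ hCr', hprod ▸ hCi', fun x hx => ?_⟩
    have hphase : φ₀ + ω * ∑ l ∈ range (J + 1), MvPolynomial.eval x (B l) =
        (φ₀ + ω * ∑ l ∈ range J, MvPolynomial.eval x (B l)) + ω * MvPolynomial.eval x (B J) := by
      rw [Finset.sum_range_succ, mul_add, add_assoc]
    rw [hphase]
    refine (happ' x hx).trans ?_
    rw [Finset.sum_range_succ, mul_add]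
    nlinarith

/-! ## §4 ★ The first-order step with mass [folklore] -/

/-- ★ **MODULE 139's FIRST-ORDER STEP, WITH COEFFICIENT MASS.**  Let `(Cr, Ci)` have masses `≤ M` and `‖Cr(x) + Ci(x)·i − e^{iθ(x)}‖ ≤ ε` on the
cube (`ε ≥ 0`), `E` a real function and `Δ` a real `MvPolynomial` of mass `≤ m_Δ` with `|ωE(x)| ≤ ρ ≤ 1`, `|ω(E(x) − Δ(x))| ≤ τ` on the cube,
`ω ≥ 0`.  Then `(Cr − ω·Ci·Δ, Ci + ω·Cr·Δ)` has masses `≤ M(1 + ω·m_Δ)` and `‖· − e^{i(θ(x) + ωE(x))}‖ ≤ ε(1 + ρ + τ) + ρ² + τ` on the cube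
(the error bookkeeping is module 139's verbatim). [folklore] -/
theorem exists_pair_firstOrder_step_mass {θ E : (ι → ℝ) → ℝ} {Cr Ci Δ : MvPolynomial ι ℝ} {M mΔ ε ρ τ ω : ℝ}
    (hCr : (∑ s ∈ Cr.support, |Cr.coeff s|) ≤ M) (hCi : (∑ s ∈ Ci.support, |Ci.coeff s|) ≤ M)
    (hΔm : (∑ s ∈ Δ.support, |Δ.coeff s|) ≤ mΔ) (hε : 0 ≤ ε) (hρ : ρ ≤ 1) (hω : 0 ≤ ω)
    (happ : ∀ x : ι → ℝ, (∀ i, x i ∈ Set.Icc (-1 : ℝ) 1) →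
      ‖((MvPolynomial.eval x Cr : ℝ) : ℂ) + ((MvPolynomial.eval x Ci : ℝ) : ℂ) * I - exp ((θ x : ℂ) * I)‖ ≤ ε)
    (hE : ∀ x : ι → ℝ, (∀ i, x i ∈ Set.Icc (-1 : ℝ) 1) → |ω * E x| ≤ ρ)
    (hEΔ : ∀ x : ι → ℝ, (∀ i, x i ∈ Set.Icc (-1 : ℝ) 1) → |ω * (E x - MvPolynomial.eval x Δ)| ≤ τ) :
    ∃ Cr' Ci' : MvPolynomial ι ℝ,
      (∑ s ∈ Cr'.support, |Cr'.coeff s|) ≤ M * (1 + ω * mΔ) ∧ (∑ s ∈ Ci'.support, |Ci'.coeff s|) ≤ M * (1 + ω * mΔ) ∧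
      ∀ x : ι → ℝ, (∀ i, x i ∈ Set.Icc (-1 : ℝ) 1) →
        ‖((MvPolynomial.eval x Cr' : ℝ) : ℂ) + ((MvPolynomial.eval x Ci' : ℝ) : ℂ) * I -
            exp (((θ x + ω * E x : ℝ) : ℂ) * I)‖ ≤ ε * (1 + ρ + τ) + ρ ^ 2 + τ := by
  have hM0 : 0 ≤ M := (Finset.sum_nonneg fun s _ => abs_nonneg _).trans hCr
  have hΔ0 : 0 ≤ ∑ s ∈ Δ.support, |Δ.coeff s| := Finset.sum_nonneg fun s _ => abs_nonneg _
  have hmassω : ∀ P : MvPolynomial ι ℝ, (∑ s ∈ P.support, |P.coeff s|) ≤ M →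
      (∑ s ∈ (MvPolynomial.C ω * P * Δ).support, |(MvPolynomial.C ω * P * Δ).coeff s|) ≤ M * (ω * mΔ) := by
    intro P hP
    calc _ ≤ (∑ s ∈ (MvPolynomial.C ω * P).support, |(MvPolynomial.C ω * P).coeff s|) * ∑ s ∈ Δ.support, |Δ.coeff s| :=
          mass_mul_le _ _
      _ ≤ (|ω| * M) * mΔ := by
          refine mul_le_mul ((mass_mul_le _ _).trans ?_) hΔm hΔ0 (by positivity)
          exact mul_le_mul (mass_C_le _) hP (Finset.sum_nonneg fun s _ => abs_nonneg _) (abs_nonneg _)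
      _ = M * (ω * mΔ) := by rw [abs_of_nonneg hω]; ring
  refine ⟨Cr - MvPolynomial.C ω * Ci * Δ, Ci + MvPolynomial.C ω * Cr * Δ, ?_, ?_, ?_⟩
  · calc _ ≤ _ := mass_sub_le _ _
      _ ≤ M + M * (ω * mΔ) := add_le_add hCr (hmassω Ci hCi)
      _ = M * (1 + ω * mΔ) := by ring
  · calc _ ≤ _ := mass_add_le _ _
      _ ≤ M + M * (ω * mΔ) := add_le_add hCi (hmassω Cr hCr)
      _ = M * (1 + ω * mΔ) := by ring
  · intro x hx
    set cr : ℝ := MvPolynomial.eval x Cr with hcr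
    set ci : ℝ := MvPolynomial.eval x Ci with hci
    set δ : ℝ := MvPolynomial.eval x Δ with hδ
    set z : ℂ := (cr : ℂ) + (ci : ℂ) * I with hz
    set u : ℂ := ((ω * E x : ℝ) : ℂ) * I with hu
    set v : ℂ := ((ω * δ : ℝ) : ℂ) * I with hv
    have hpair : ((MvPolynomial.eval x (Cr - MvPolynomial.C ω * Ci * Δ) : ℝ) : ℂ) +
        ((MvPolynomial.eval x (Ci + MvPolynomial.C ω * Cr * Δ) : ℝ) : ℂ) * I = z * (1 + v) := by
      simp only [map_sub, map_add, map_mul, MvPolynomial.eval_C, hz, hv, ← hcr, ← hci, ← hδ]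
      push_cast
      linear_combination (-(ω : ℂ) * (ci : ℂ) * (δ : ℂ)) * Complex.I_mul_I
    have harg : ((θ x + ω * E x : ℝ) : ℂ) * I = (θ x : ℂ) * I + u := by rw [hu]; push_cast; ring
    have hexp : exp (((θ x + ω * E x : ℝ) : ℂ) * I) = exp ((θ x : ℂ) * I) * exp u := by rw [harg, Complex.exp_add]
    rw [hpair, hexp]
    have hρx : |ω * E x| ≤ ρ := hE x hx
    have hτx : |ω * (E x - δ)| ≤ τ := hEΔ x hx
    have hnu : ‖u‖ ≤ ρ := by
      rw [hu, norm_mul, Complex.norm_real, Complex.norm_I, mul_one, Real.norm_eq_abs]; exact hρx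
    have hnuv : ‖u - v‖ ≤ τ := by
      have e : u - v = ((ω * (E x - δ) : ℝ) : ℂ) * I := by rw [hu, hv]; push_cast; ring
      rw [e, norm_mul, Complex.norm_real, Complex.norm_I, mul_one, Real.norm_eq_abs]; exact hτx
    have hnv : ‖v‖ ≤ ρ + τ := by
      calc ‖v‖ = ‖u - (u - v)‖ := by rw [sub_sub_cancel]
        _ ≤ ‖u‖ + ‖u - v‖ := norm_sub_le _ _
        _ ≤ ρ + τ := add_le_add hnu hnuv
    have hn1v : ‖1 + v‖ ≤ 1 + ρ + τ := by
      calc ‖1 + v‖ ≤ ‖(1 : ℂ)‖ + ‖v‖ := norm_add_le _ _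
        _ ≤ 1 + (ρ + τ) := by rw [norm_one]; exact add_le_add le_rfl hnv
        _ = 1 + ρ + τ := by ring
    have hrem : ‖exp u - 1 - u‖ ≤ ρ ^ 2 := by
      calc ‖exp u - 1 - u‖ ≤ ‖u‖ ^ 2 := Complex.norm_exp_sub_one_sub_id_le (hnu.trans hρ)
        _ ≤ ρ ^ 2 := pow_le_pow_left₀ (norm_nonneg _) hnu 2
    have hzerr : ‖z - exp ((θ x : ℂ) * I)‖ ≤ ε := happ x hx
    have hsplit : z * (1 + v) - exp ((θ x : ℂ) * I) * exp u =
        (z - exp ((θ x : ℂ) * I)) * (1 + v) - exp ((θ x : ℂ) * I) * ((exp u - 1 - u) + (u - v)) := by ring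
    rw [hsplit]
    calc ‖(z - exp ((θ x : ℂ) * I)) * (1 + v) - exp ((θ x : ℂ) * I) * ((exp u - 1 - u) + (u - v))‖
        ≤ ‖(z - exp ((θ x : ℂ) * I)) * (1 + v)‖ + ‖exp ((θ x : ℂ) * I) * ((exp u - 1 - u) + (u - v))‖ := norm_sub_le _ _
      _ = ‖z - exp ((θ x : ℂ) * I)‖ * ‖1 + v‖ + 1 * ‖(exp u - 1 - u) + (u - v)‖ := by
          rw [norm_mul, norm_mul, Complex.norm_exp_ofReal_mul_I]
      _ ≤ ε * (1 + ρ + τ) + 1 * (ρ ^ 2 + τ) := by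
          refine add_le_add (mul_le_mul hzerr hn1v (norm_nonneg _) hε) (mul_le_mul_of_nonneg_left ?_ zero_le_one)
          exact (norm_add_le _ _).trans (add_le_add hrem hnuv)
      _ = ε * (1 + ρ + τ) + ρ ^ 2 + τ := by ring

end Summit.QuantumFields.YangMills.Theorems.BalabanUVNodesN19SingleModeMomentFirstOrder

end
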